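import Summits.QuantumFields.BalabanUV.Beta.GAN24.FaceWordsDeepCurrents
import Summits.QuantumFields.BalabanUV.Beta.GAN24.DressedVertexFacePush
import Summits.QuantumFields.BalabanUV.Beta.GAN24.RespWordsLegAntisymm

/-!
# `BalabanUV.Beta.GAN24.FaceWWordLetters` — binder row G-an2-4 ∕ (CONV-C), W-slot (α-0), ROW (C)sym AT LEVELS `≥ 1` (rows T6-STEP of the OWNER's
# two-index tower, RULING R-gan24p1-g40-1): **THE `W`-WORD OF leaf-06 K6c ON FACES — ITS TWO MIXED WORDS VANISH AND ITS TWO RESPONSE WORDS ARE LEG-ODD** —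
# Part 48 of `GAN24/FourFaceGaugeSectors` (G-an2-4 CRUX TEAM (2), leaf prover `b2b-balaban-gan24-formalise-leaf-02`, gen 69; the third word of Part 47
# `FourFaceSourceWordsDeep.faceRead_dressedSource_inl_inl`)

NOT IN PRINT; OUR BOOKKEEPING ([folklore] BY NAME over Part 46 `DressedVertexFacePush.hasSum_coordWeight_vertexOfM_dressedStep_slice` (the multiplier column dies against
a single-coordinate weight in its own direction — road-P2 g41 `tsum_coord_colM`), an2's `SecondOrderResponse.biLoc_vertexOfM_slice ∕ biLoc_wsum_self_far ∕ mixOfK_translate`,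
leaf-06 K4a `JointPeriodicCellSwap.sum_box_tsum_swap_weight`, Part 41 `RespWordsLegAntisymm.tsum_facePair_swap_of_ff_antisymm ∕ ff_antisymm_of_parityOdd` and an1's
`SpineRecursiveParity.parityOdd_dM`; 0 `def`, 0 cited fact, 0 `def … : Prop`, 0 sorry).  HONEST FRAMING (cell contract, verbatim): «discharging `BetaPertH` makes
Bałaban's UV stability UNCONDITIONAL — a real constructive-QFT result; it is NOT the continuum limit and NOT the Clay problem.»  HONEST DEPENDENCY (verbatim):
«continuum YM on T⁴ ⇐ BetaPertH ∧ nine spine estimates (0/9 proved); BetaPertH ⇐ (D1) ∧ (D4) ∧ CAP+tail; G-an2-4 gates asym, D1 and NE2/3/4.»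

WHAT.  In Part 47's third word the table is road-P2's `W = W2SymOfK X̃♮_j Lc S̃ M̃ 0 M̃₂`; by `W2SymOfK`'s definition, `W2OfK_apply` and `T2RecursionAffine.vertex2OfK_zero` it is,
bond by bond, `mixOfK X̃ Lc M̃₂ μ r′ ν u′ + mixOfK X̃ Lc M̃₂ ν u′ μ r′ + ½·dM (K2OfK X̃ Lc S̃ M̃ ν u′) Lc S̃ M̃ μ r′ + ½·dM (K2OfK X̃ Lc S̃ M̃ μ r′) Lc S̃ M̃ ν u′` (the assembler's
`rfl`-level split; not restated here).  THIS FILE, for `X̃ := unitK sf sm (coDressKBmAt (toSite r) Lc (KInvStep Lc j))` (ANY units, every `j`, in-block root), ANY mixed table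
`M₂` (`LocStencilFM Lc M₂ C₂ δ₂`), ANY first tables `S`, `M` with parity-odd rows, bounded weights and ANY integer leg modulus:
* §1 `trK_unitS_of_rows`, `trK_unitM_of_rows` (row parity passes the unit rescalings), **`resp_facePair_swap`** (for ANY weight kernel `K′`: the exit-face leg pair sum of
  `dM K′ Lc S M μ y` is odd under the exchange of the two leg directions — so both response words have zero leg-and-bond symmetrised charge `LS`, Part 41 `legSym_eq_zero_of_swap`).
* §2 **`biLoc_mixOfK_far`**: `mixOfK K N M₂ μ y ν y′` is bi-localised at `N•y` with the inner-distance factor `e^{−(m/8)|N•y − N•y′|₁}` (an2's `biLoc_wsum_self_far`; the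
  intermediate of `vertexFamily₂_mixOfK_swap` made a theorem).
* §3 **`hasSum_coordWeight_mixOfK_snd`**: `HasSum (y′ ↦ f(y′_ν)·mixOfK X̃ Lc M₂ μ y ν y′ x z a b) 0` — the mixed word dies ENTRYWISE under a single-coordinate weight on its
  multiplier-column bond (one dominated exchange over `(y′, u)` and Part 46's slice zero).
* §4 face level: **`tsum_faceBond_mixWord_eq_zero`** (`Σ'_{u′} w u′·Σ'_{(y,w)} m·mixOfK X̃ Lc M₂ μ r′ ν u′ (y,w)(a,b) = 0` for the weight `w u′ = f(u′_ν)` — the direct mixed word,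
  free multiplier bond) and **`sum_box_tsum_mixWord_swap_eq_zero`** (`Σ_{r′∈box P} Σ'_{u′} w μ r′·w ν u′·Σ' m·mixOfK X̃ Lc M₂ ν u′ μ r′ (y,w)(a,b) = 0` — the exchanged mixed word, whose
  multiplier bond is the CELL bond: K4a moves the cell onto `u′` first; `(P, Lc·P)`-covariant `M₂`, `P`-periodic bond weights, `Lc·P`-periodic leg weight).
Asserts NO value of any table; discharges NOTHING of (C)_{≥1} ∕ `hstep` ∕ `hSrc` ∕ `hSrcX` ∕ (Q-L) ∕ (hW, hWall); NEVER «G-an2-4 closed» as (CONV-C); NOT D1, NOT `BetaPertH`,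
NOT continuum, NOT Clay.  2026-08-24; no existing file touched.
-/

noncomputable section

open Finset
open scoped BigOperators
open Literature.MathematicalPhysics.QuantumFieldTheory
open Literature.MathematicalPhysics.QuantumFieldTheory.Balaban1983to89
open Literature.MathematicalPhysics.QuantumFieldTheory.Balaban1983to89.Beta
open B12Sec2to5 (l1 l1_nonneg)
open ExpKernelCalculus (Site MKer Decays BiLoc shiftK exp_mid l1_sub_symm Zl Zl_pos Zl_nonneg summable_exp_shift summable_exp_shift' tsum_exp_shift')
open OneStepResolventKernel (Fib LocStencil biLoc_mono bound_mono wsum)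
open AffineAveraging (box toSite)
open OneStepKernelFamily (KInvStep decays_KInvStep colH abs_colH_le vertexOfK shiftK_KInvStep)
open SecondOrderResponse (colM vertexOfM dM mixOfK LocStencilFM biLoc_vertexOfM_slice biLoc_wsum_self_far mixOfK_translate)
open Summit.QuantumFields.BalabanUV.Beta.TameKernelCalculus (trK trK_apply)
open Summit.QuantumFields.BalabanUV.Beta.BorderedHessian (sgnF sgnF_inl sgnF_inr sgnK sgnK_apply)
open Summit.QuantumFields.BalabanUV.Beta.AxialDressingRooted (coDressKBmAt shiftK_coDressKBmAt decays_coDressKBmAt)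
open Summit.QuantumFields.BalabanUV.Beta.HessKerDressedUnits (unitK unitS unitS_apply legScale decays_unitK)
open Summit.QuantumFields.BalabanUV.Beta.SecondOrderUnits (unitM unitM_apply)
open Summit.QuantumFields.BalabanUV.Beta.SpineRecursiveParity (parityOdd_dM)
open Summit.QuantumFields.BalabanUV.Beta.GAN24.RespWordsLegAntisymm (tsum_facePair_swap_of_ff_antisymm ff_antisymm_of_parityOdd)
open Summit.QuantumFields.BalabanUV.Beta.GAN24.JointPeriodicCellSwap (sum_box_tsum_swap_weight)
open Summit.QuantumFields.BalabanUV.Beta.GAN24.FaceWordsDeepCurrents (abs_tsum_weightPair_le tsum_weightPair_shiftK sum_tsum_factor)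
open Summit.QuantumFields.BalabanUV.Beta.GAN24.DressedVertexFacePush (hasSum_coordWeight_vertexOfM_dressedStep_slice)

namespace Summit.QuantumFields.BalabanUV.Beta.GAN24.FaceWWordLetters

variable {d : ℕ}

/-! ## §1 The response words are leg-odd (any weight kernel, any modulus, unit-rescaled tables) -/

section Resp

/-- [folklore] Row parity passes the first-order unit rescaling `unitS` (the factor `(sf·sm)⁻¹·ℓ(a)·ℓ(b)` is symmetric under `(a, b) ↔ (b, a)`). -/
theorem trK_unitS_of_rows {S : Fin (d + 1) → (Fin (d + 1) → ℤ) → MKer (d + 1) (Fib d)} (hS : ∀ κ u, trK (S κ u) = -sgnK (S κ u))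
    (sf sm : ℝ) (κ : Fin (d + 1)) (u : Fin (d + 1) → ℤ) : trK (unitS sf sm S κ u) = -sgnK (unitS sf sm S κ u) := by
  funext x z a b
  have h := congrFun (congrFun (congrFun (congrFun (hS κ u) x) z) a) b
  simp only [trK_apply, Pi.neg_apply, sgnK_apply] at h
  simp only [trK_apply, Pi.neg_apply, sgnK_apply, unitS_apply]
  rw [h]
  ring

/-- [folklore] Row parity passes the multiplier-table unit rescaling `unitM`. -/
theorem trK_unitM_of_rows {M : Fin (d + 1) → (Fin (d + 1) → ℤ) → MKer (d + 1) (Fib d)} (hM : ∀ ρ w, trK (M ρ w) = -sgnK (M ρ w))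
    (sf sm : ℝ) (ρ : Fin (d + 1)) (w : Fin (d + 1) → ℤ) : trK (unitM sf sm M ρ w) = -sgnK (unitM sf sm M ρ w) := by
  funext x z a b
  have h := congrFun (congrFun (congrFun (congrFun (hM ρ w) x) z) a) b
  simp only [trK_apply, Pi.neg_apply, sgnK_apply] at h
  simp only [trK_apply, Pi.neg_apply, sgnK_apply, unitM_apply]
  rw [h]
  ring

/-- NOT IN PRINT; OUR BOOKKEEPING.  **THE RESPONSE WORD's EXIT-FACE LEG PAIR IS ODD UNDER THE EXCHANGE OF THE TWO LEG DIRECTIONS** (ANY weight kernel `K′` — at the use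
site `K′ = K2OfK X̃ Lc S̃ M̃ ν u′` resp. `… μ r′`; ANY blocking `L`; ANY integer leg modulus `N`; first tables with parity-odd rows, e.g. `unitS … (SpureRecAt …)` and
`unitM … (M1At …)` by §1 with `SpineRecursivePureParity.trK_SpureRecAt` ∕ `SpineRecursiveParity.trK_M1At`):
`Σ'_{(x,z)} [x_β][z_α]·dM K′ L S M μ y x z (inl β)(inl α) = −Σ'_{(x,z)} [x_α][z_β]·dM K′ L S M μ y x z (inl α)(inl β)`. -/
theorem resp_facePair_swap (N : ℤ) (K' : MKer (d + 1) (Fib d)) (L : ℕ) {S M : Fin (d + 1) → (Fin (d + 1) → ℤ) → MKer (d + 1) (Fib d)}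
    (hS : ∀ κ u, trK (S κ u) = -sgnK (S κ u)) (hM : ∀ ρ w, trK (M ρ w) = -sgnK (M ρ w)) (μ : Fin (d + 1)) (y : Fin (d + 1) → ℤ) (α β : Fin (d + 1)) :
    ∑' xz : Site (d + 1) × Site (d + 1), (if xz.1 β % N = N - 1 then (1 : ℝ) else 0) * (if xz.2 α % N = N - 1 then (1 : ℝ) else 0) *
        dM K' L S M μ y xz.1 xz.2 (Sum.inl β) (Sum.inl α)
      = -∑' xz : Site (d + 1) × Site (d + 1), (if xz.1 α % N = N - 1 then (1 : ℝ) else 0) * (if xz.2 β % N = N - 1 then (1 : ℝ) else 0) *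
        dM K' L S M μ y xz.1 xz.2 (Sum.inl α) (Sum.inl β) :=
  tsum_facePair_swap_of_ff_antisymm N fun x z => ff_antisymm_of_parityOdd (parityOdd_dM K' L hS hM μ y) x z α β

end Resp

/-! ## §2 The mixed bi-vertex is bi-localised at its field-column bond with the inner-distance factor -/

section MixFar

variable {N : ℕ} [NeZero N] {K : MKer (d + 1) (Fib d)} {C m : ℝ}
  {M₂ : Fin (d + 1) → (Fin (d + 1) → ℤ) → Fin (d + 1) → (Fin (d + 1) → ℤ) → MKer (d + 1) (Fib d)} {C₂ : ℝ}

/-- NOT IN PRINT; OUR BOOKKEEPING.  **THE MIXED BI-VERTEX IS BI-LOCALISED AT ITS FIELD-COLUMN BOND, SMALL IN THE DISTANCE OF THE TWO BONDS**: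
`BiLoc (mixOfK K N M₂ μ y ν y′) (N•y) (N•y) (cfar·e^{−(m/8)|N•y − N•y′|₁}) (m/8)` (`biLoc_vertexOfM_slice` ⨾ `biLoc_wsum_self_far`; the decaying constant that
`vertexFamily₂_mixOfK_swap` spends on re-centring is kept). -/
theorem biLoc_mixOfK_far (hK : Decays K C m) (hC : 0 ≤ C) (hM₂ : LocStencilFM N M₂ C₂ m) (hm : 0 < m)
    (μ : Fin (d + 1)) (y : Fin (d + 1) → ℤ) (ν : Fin (d + 1)) (y' : Fin (d + 1) → ℤ) :
    BiLoc (mixOfK K N M₂ μ y ν y') ((N : ℤ) • y) ((N : ℤ) • y)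
      ((d + 1 : ℕ) * (C * ((d + 1 : ℕ) * (C * C₂ * Zl (d + 1) (m / 2))) * Zl (d + 1) (m / 2 / 4)
        * Real.exp (-(m / 2 / 4) * l1 ((N : ℤ) • y - (N : ℤ) • y')))) (m / 2 / 4) := by
  have hC₂ := hM₂.nonneg
  have hK₁ : 0 ≤ (d + 1 : ℕ) * (C * C₂ * Zl (d + 1) (m / 2)) := by
    have := Zl_nonneg (D := d + 1) (half_pos hm); positivity
  have hin : ∀ (κ : Fin (d + 1)) (u : Fin (d + 1) → ℤ), BiLoc (vertexOfM K N (M₂ κ u) ν y') u u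
      ((d + 1 : ℕ) * (C * C₂ * Zl (d + 1) (m / 2)) * Real.exp (-(m / 2) * l1 (u - (N : ℤ) • y'))) (m / 2) := by
    intro κ u
    have h := biLoc_vertexOfM_slice (N := N) hK hC hM₂ hm κ u ν y'
    rw [← mul_assoc] at h
    exact biLoc_mono h (by positivity) (by linarith)
  have hw : ∀ (κ : Fin (d + 1)) (u : Fin (d + 1) → ℤ), |colH K N μ y κ u| ≤ C * Real.exp (-(m / 2) * l1 (u - (N : ℤ) • y)) :=
    fun κ u => bound_mono (abs_colH_le (N := N) hK μ y κ u) hC le_rfl (by linarith) (l1_nonneg _)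
  have hterm : ∀ κ : Fin (d + 1), BiLoc (wsum (colH K N μ y κ) (fun u => vertexOfM K N (M₂ κ u) ν y'))
      ((N : ℤ) • y) ((N : ℤ) • y) (C * ((d + 1 : ℕ) * (C * C₂ * Zl (d + 1) (m / 2))) * Zl (d + 1) (m / 2 / 4)
        * Real.exp (-(m / 2 / 4) * l1 ((N : ℤ) • y - (N : ℤ) • y'))) (m / 2 / 4) :=
    fun κ => biLoc_wsum_self_far (hw κ) (hin κ) (half_pos hm) hC hK₁
  have hsum := OneStepResolventKernel.biLoc_finset_sum (Finset.univ : Finset (Fin (d + 1))) (fun κ _ => hterm κ)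
  simp only [Finset.sum_const, Finset.card_univ, Fintype.card_fin, nsmul_eq_mul] at hsum
  exact hsum

end MixFar

/-! ## §3 The mixed word dies entrywise under a single-coordinate weight on its multiplier-column bond -/

section MixEntry

variable {Lc : ℕ} [NeZero Lc] {r : Fin (d + 1) → ℕ}

omit [NeZero Lc] in
/-- [folklore] `LocStencilFM` is monotone in the rate (both the inner-distance factor and the leg rate may be lowered). -/
theorem locStencilFM_mono {M₂ : Fin (d + 1) → Site (d + 1) → Fin (d + 1) → Site (d + 1) → MKer (d + 1) (Fib d)} {C δ δ' : ℝ}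
    (hM : LocStencilFM Lc M₂ C δ) (hC : 0 ≤ C) (hδ' : δ' ≤ δ) : LocStencilFM Lc M₂ C δ' := by
  intro κ u ρ w x z a b
  refine (hM κ u ρ w x z a b).trans ?_
  rw [mul_assoc, mul_assoc, ← Real.exp_add, ← Real.exp_add]
  refine mul_le_mul_of_nonneg_left (Real.exp_le_exp.2 ?_) hC
  nlinarith [l1_nonneg (u - (Lc : ℤ) • w), l1_nonneg (x - u), l1_nonneg (z - u)]

/-- NOT IN PRINT; OUR BOOKKEEPING.  **`HasSum (y′ ↦ f(y′_ν)·mixOfK X̃ Lc M₂ μ y ν y′ x z a b) 0`** (every bounded `f : ℤ → ℝ`, every field-column bond `(μ, y)`, every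
entry): `mixOfK … x z a b = Σ_κ Σ'_u colH X̃ Lc μ y κ u·vertexOfM X̃ Lc (M₂ κ u) ν y′ x z a b`; the double family over `(y′, u)` converges absolutely (`colH` decays from `Lc•y`,
the slice vertex from `Lc•y′` through `u` — `exp_mid`), and for every `u` the `y′`-fibre is Part 46's slice zero. -/
theorem hasSum_coordWeight_mixOfK_snd (hLc : 1 ≤ Lc) (hr : r ∈ box (d + 1) Lc) (sf sm : ℝ) (j : ℕ)
    {M₂ : Fin (d + 1) → Site (d + 1) → Fin (d + 1) → Site (d + 1) → MKer (d + 1) (Fib d)} {C₂ δ₂ : ℝ} (hM₂ : LocStencilFM Lc M₂ C₂ δ₂) (hδ₂ : 0 < δ₂)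
    (μ : Fin (d + 1)) (y : Site (d + 1)) (ν : Fin (d + 1)) (f : ℤ → ℝ) {B : ℝ} (hf : ∀ s, |f s| ≤ B) (x z : Site (d + 1)) (a b : Fib d) :
    HasSum (fun y' : Site (d + 1) => f (y' ν) * mixOfK (unitK sf sm (coDressKBmAt (toSite r) Lc (KInvStep (d := d) Lc j))) Lc M₂ μ y ν y' x z a b) 0 := by
  classical
  -- common rate
  obtain ⟨δ, C', hδ, hC', hK'⟩ := decays_coDressKBmAt hLc hr (decays_KInvStep (d := d) (Lc := Lc) j)
  have hKu := decays_unitK (sf := sf) (sm := sm) hK'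
  set CK : ℝ := max |sf| |sm| * C' * max |sf| |sm| with hCK
  have hCK0 : 0 ≤ CK := hKu.nonneg (Sum.inl 0)
  have hC₂ : 0 ≤ C₂ := hM₂.nonneg
  set m : ℝ := min δ δ₂ with hm
  have hm0 : 0 < m := lt_min hδ hδ₂
  have hKm : Decays (unitK sf sm (coDressKBmAt (toSite r) Lc (KInvStep (d := d) Lc j))) CK m :=
    OneStepResolventKernel.decays_mono hKu hCK0 le_rfl (min_le_left _ _)
  have hM₂m : LocStencilFM Lc M₂ C₂ m := locStencilFM_mono hM₂ hC₂ (min_le_right _ _)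
  have hB : 0 ≤ B := (abs_nonneg _).trans (hf 0)
  -- bounds
  set Cv : ℝ := (d + 1 : ℕ) * (CK * C₂ * Zl (d + 1) (m / 2)) with hCv
  have hCv0 : 0 ≤ Cv := by have := Zl_nonneg (D := d + 1) (half_pos hm0); positivity
  have hV : ∀ (κ : Fin (d + 1)) (u y' : Site (d + 1)),
      |vertexOfM (unitK sf sm (coDressKBmAt (toSite r) Lc (KInvStep (d := d) Lc j))) Lc (M₂ κ u) ν y' x z a b|
        ≤ Cv * Real.exp (-(m / 2) * l1 (u - (Lc : ℤ) • y')) := by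
    intro κ u y'
    have h := biLoc_vertexOfM_slice (N := Lc) hKm hCK0 hM₂m hm0 κ u ν y' x z a b
    refine h.trans ?_
    rw [← mul_assoc]
    have h1 : Real.exp (-m * (l1 (x - u) + l1 (z - u))) ≤ 1 := by
      rw [Real.exp_le_one_iff]; nlinarith [l1_nonneg (x - u), l1_nonneg (z - u), hm0.le]
    have h0 : 0 ≤ Cv * Real.exp (-(m / 2) * l1 (u - (Lc : ℤ) • y')) := by positivity
    calc (d + 1 : ℕ) * (CK * C₂ * Zl (d + 1) (m / 2)) * Real.exp (-(m / 2) * l1 (u - (Lc : ℤ) • y')) * Real.exp (-m * (l1 (x - u) + l1 (z - u)))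
        ≤ Cv * Real.exp (-(m / 2) * l1 (u - (Lc : ℤ) • y')) * 1 := mul_le_mul_of_nonneg_left h1 h0
      _ = _ := mul_one _
  have hH : ∀ (κ : Fin (d + 1)) (u : Site (d + 1)),
      |colH (unitK sf sm (coDressKBmAt (toSite r) Lc (KInvStep (d := d) Lc j))) Lc μ y κ u| ≤ CK * Real.exp (-(m / 2) * l1 (u - (Lc : ℤ) • y)) :=
    fun κ u => bound_mono (abs_colH_le (N := Lc) hKm μ y κ u) hCK0 le_rfl (by linarith) (l1_nonneg _)
  -- the double family over `(y′, u)` per field direction `κ`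
  have hF : ∀ κ : Fin (d + 1), Summable fun q : Site (d + 1) × Site (d + 1) =>
      f (q.1 ν) * (colH (unitK sf sm (coDressKBmAt (toSite r) Lc (KInvStep (d := d) Lc j))) Lc μ y κ q.2 *
        vertexOfM (unitK sf sm (coDressKBmAt (toSite r) Lc (KInvStep (d := d) Lc j))) Lc (M₂ κ q.2) ν q.1 x z a b) := by
    intro κ
    have hg : Summable fun q : Site (d + 1) × Site (d + 1) =>
        Real.exp (-(m / 2 / 2) * l1 ((Lc : ℤ) • y - (Lc : ℤ) • q.1)) * Real.exp (-(m / 2 / 2) * l1 (q.2 - (Lc : ℤ) • y)) := by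
      have h1 : Summable fun y' : Site (d + 1) => Real.exp (-(m / 2 / 2) * l1 ((Lc : ℤ) • y - (Lc : ℤ) • y')) :=
        (KernelLegCharges.summable_exp_coarse hLc (by positivity : 0 < m / 2 / 2) ((Lc : ℤ) • y)).congr fun y' => by rw [l1_sub_symm]
      exact h1.mul_of_nonneg (summable_exp_shift' (by positivity) _) (fun _ => (Real.exp_pos _).le) (fun _ => (Real.exp_pos _).le)
    refine Summable.of_norm_bounded (hg.mul_left (B * (CK * Cv))) (fun q => ?_)
    rw [Real.norm_eq_abs, abs_mul, abs_mul]
    have e := exp_mid (show (0 : ℝ) ≤ m / 2 by positivity) q.2 ((Lc : ℤ) • y) ((Lc : ℤ) • q.1)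
    have h2 : |colH (unitK sf sm (coDressKBmAt (toSite r) Lc (KInvStep (d := d) Lc j))) Lc μ y κ q.2| *
        |vertexOfM (unitK sf sm (coDressKBmAt (toSite r) Lc (KInvStep (d := d) Lc j))) Lc (M₂ κ q.2) ν q.1 x z a b|
        ≤ CK * Cv * Real.exp (-(m / 2) * (l1 (q.2 - (Lc : ℤ) • y) + l1 (q.2 - (Lc : ℤ) • q.1))) := by
      calc _ ≤ (CK * Real.exp (-(m / 2) * l1 (q.2 - (Lc : ℤ) • y))) * (Cv * Real.exp (-(m / 2) * l1 (q.2 - (Lc : ℤ) • q.1))) :=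
            mul_le_mul (hH κ q.2) (hV κ q.2 q.1) (abs_nonneg _) (by positivity)
        _ = CK * Cv * Real.exp (-(m / 2) * (l1 (q.2 - (Lc : ℤ) • y) + l1 (q.2 - (Lc : ℤ) • q.1))) := by rw [mul_add, Real.exp_add]; ring
    calc |f (q.1 ν)| * (|colH _ Lc μ y κ q.2| * |vertexOfM _ Lc (M₂ κ q.2) ν q.1 x z a b|)
        ≤ B * (CK * Cv * Real.exp (-(m / 2) * (l1 (q.2 - (Lc : ℤ) • y) + l1 (q.2 - (Lc : ℤ) • q.1)))) :=
          mul_le_mul (hf _) h2 (mul_nonneg (abs_nonneg _) (abs_nonneg _)) hB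
      _ ≤ B * (CK * Cv * (Real.exp (-(m / 2 / 2) * l1 ((Lc : ℤ) • y - (Lc : ℤ) • q.1)) * Real.exp (-(m / 2 / 2) * l1 (q.2 - (Lc : ℤ) • y)))) := by
          gcongr
      _ = B * (CK * Cv) * (Real.exp (-(m / 2 / 2) * l1 ((Lc : ℤ) • y - (Lc : ℤ) • q.1)) * Real.exp (-(m / 2 / 2) * l1 (q.2 - (Lc : ℤ) • y))) := by ring
  -- the `y′`-fibres vanish (Part 46), the `u`-fibres are summable: total = 0 either way
  have hfib : ∀ (κ : Fin (d + 1)) (u : Site (d + 1)), HasSum (fun y' : Site (d + 1) =>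
      f (y' ν) * (colH (unitK sf sm (coDressKBmAt (toSite r) Lc (KInvStep (d := d) Lc j))) Lc μ y κ u *
        vertexOfM (unitK sf sm (coDressKBmAt (toSite r) Lc (KInvStep (d := d) Lc j))) Lc (M₂ κ u) ν y' x z a b)) 0 := by
    intro κ u
    have h := (hasSum_coordWeight_vertexOfM_dressedStep_slice hLc hr sf sm j ν f hf hM₂ hδ₂ κ u x z a b).mul_left
      (colH (unitK sf sm (coDressKBmAt (toSite r) Lc (KInvStep (d := d) Lc j))) Lc μ y κ u)
    rw [mul_zero] at h
    exact h.congr_fun fun y' => by ring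
  have hκ : ∀ κ : Fin (d + 1), HasSum (fun y' : Site (d + 1) => ∑' u : Site (d + 1),
      f (y' ν) * (colH (unitK sf sm (coDressKBmAt (toSite r) Lc (KInvStep (d := d) Lc j))) Lc μ y κ u *
        vertexOfM (unitK sf sm (coDressKBmAt (toSite r) Lc (KInvStep (d := d) Lc j))) Lc (M₂ κ u) ν y' x z a b)) 0 := by
    intro κ
    -- total over the product: summing `y′` first fibrewise gives 0
    have hswap : Summable fun q : Site (d + 1) × Site (d + 1) =>
        f (q.2 ν) * (colH (unitK sf sm (coDressKBmAt (toSite r) Lc (KInvStep (d := d) Lc j))) Lc μ y κ q.1 *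
          vertexOfM (unitK sf sm (coDressKBmAt (toSite r) Lc (KInvStep (d := d) Lc j))) Lc (M₂ κ q.1) ν q.2 x z a b) := (hF κ).prod_symm
    have htot : HasSum (fun q : Site (d + 1) × Site (d + 1) =>
        f (q.2 ν) * (colH (unitK sf sm (coDressKBmAt (toSite r) Lc (KInvStep (d := d) Lc j))) Lc μ y κ q.1 *
          vertexOfM (unitK sf sm (coDressKBmAt (toSite r) Lc (KInvStep (d := d) Lc j))) Lc (M₂ κ q.1) ν q.2 x z a b)) 0 := by
      have h := hswap.hasSum
      have hval : ∑' q : Site (d + 1) × Site (d + 1), f (q.2 ν) * (colH (unitK sf sm (coDressKBmAt (toSite r) Lc (KInvStep (d := d) Lc j))) Lc μ y κ q.1 *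
          vertexOfM (unitK sf sm (coDressKBmAt (toSite r) Lc (KInvStep (d := d) Lc j))) Lc (M₂ κ q.1) ν q.2 x z a b) = 0 := by
        rw [hswap.tsum_prod]
        simp_rw [(hfib κ _).tsum_eq]
        exact tsum_zero
      rwa [hval] at h
    -- summing `u` first: the fibrewise sums in the other order
    have h2 := (hF κ).hasSum
    have hval2 : ∑' q : Site (d + 1) × Site (d + 1), f (q.1 ν) * (colH (unitK sf sm (coDressKBmAt (toSite r) Lc (KInvStep (d := d) Lc j))) Lc μ y κ q.2 *
        vertexOfM (unitK sf sm (coDressKBmAt (toSite r) Lc (KInvStep (d := d) Lc j))) Lc (M₂ κ q.2) ν q.1 x z a b) = 0 := by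
      rw [← (Equiv.prodComm (Site (d + 1)) (Site (d + 1))).tsum_eq]
      exact htot.tsum_eq
    rw [hval2] at h2
    exact h2.prod_fiberwise fun y' => ((hF κ).prod_factor y').hasSum
  -- assemble over `κ` and unfold `mixOfK`
  have hsum := hasSum_sum (s := (Finset.univ : Finset (Fin (d + 1)))) fun κ _ => hκ κ
  rw [Finset.sum_const_zero] at hsum
  refine hsum.congr_fun fun y' => ?_
  simp only [SecondOrderResponse.mixOfK, OneStepKernelFamily.vertexOfK, OneStepResolventKernel.wsum]
  rw [Finset.mul_sum]
  refine Finset.sum_congr rfl fun κ _ => ?_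
  rw [← tsum_mul_left]

end MixEntry

/-! ## §4 Face level: the direct mixed word (free multiplier bond) and the exchanged one (cell on the multiplier bond) vanish -/

section MixFace

variable {Lc : ℕ} [NeZero Lc] {r : Fin (d + 1) → ℕ}

/-- NOT IN PRINT; OUR BOOKKEEPING.  **THE DIRECT MIXED FACE WORD VANISHES** (field column at any bond `(μ, y)`, multiplier column summed over its bond `u′` against a bounded
single-coordinate weight `f(u′_ν)`, legs against a bounded pair weight `m`): `Σ'_{u′} f(u′_ν)·Σ'_{(y₁,w)} m·mixOfK X̃ Lc M₂ μ y ν u′ (y₁,w)(a,b) = 0` (one dominated exchange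
over `(u′, (y₁,w))` by §2, then §3 fibrewise). -/
theorem tsum_faceBond_mixWord_eq_zero (hLc : 1 ≤ Lc) (hr : r ∈ box (d + 1) Lc) (sf sm : ℝ) (j : ℕ)
    {M₂ : Fin (d + 1) → Site (d + 1) → Fin (d + 1) → Site (d + 1) → MKer (d + 1) (Fib d)} {C₂ δ₂ : ℝ} (hM₂ : LocStencilFM Lc M₂ C₂ δ₂) (hδ₂ : 0 < δ₂)
    (μ : Fin (d + 1)) (y : Site (d + 1)) (ν : Fin (d + 1)) (f : ℤ → ℝ) {B : ℝ} (hf : ∀ s, |f s| ≤ B)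
    (m : Site (d + 1) × Site (d + 1) → ℝ) (hm : ∀ yw, |m yw| ≤ 1) (a b : Fib d) :
    ∑' u' : Site (d + 1), f (u' ν) * ∑' yw : Site (d + 1) × Site (d + 1), m yw *
        mixOfK (unitK sf sm (coDressKBmAt (toSite r) Lc (KInvStep (d := d) Lc j))) Lc M₂ μ y ν u' yw.1 yw.2 a b = 0 := by
  classical
  obtain ⟨δ, C', hδ, hC', hK'⟩ := decays_coDressKBmAt hLc hr (decays_KInvStep (d := d) (Lc := Lc) j)
  have hKu := decays_unitK (sf := sf) (sm := sm) hK'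
  have hCK0 : 0 ≤ max |sf| |sm| * C' * max |sf| |sm| := hKu.nonneg (Sum.inl 0)
  have hC₂ : 0 ≤ C₂ := hM₂.nonneg
  set m₀ : ℝ := min δ δ₂ with hm₀
  have hm0 : 0 < m₀ := lt_min hδ hδ₂
  have hKm : Decays (unitK sf sm (coDressKBmAt (toSite r) Lc (KInvStep (d := d) Lc j))) (max |sf| |sm| * C' * max |sf| |sm|) m₀ :=
    OneStepResolventKernel.decays_mono hKu hCK0 le_rfl (min_le_left δ δ₂)
  have hM₂m : LocStencilFM Lc M₂ C₂ m₀ := locStencilFM_mono hM₂ hC₂ (min_le_right _ _)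
  have hB : 0 ≤ B := (abs_nonneg _).trans (hf 0)
  have hW := fun u' => biLoc_mixOfK_far (N := Lc) hKm hCK0 hM₂m hm0 μ y ν u'
  set cf : ℝ := (d + 1 : ℕ) * (max |sf| |sm| * C' * max |sf| |sm| * ((d + 1 : ℕ) * (max |sf| |sm| * C' * max |sf| |sm| * C₂ * Zl (d + 1) (m₀ / 2))) *
    Zl (d + 1) (m₀ / 2 / 4)) with hcf
  have hm8 : 0 < m₀ / 2 / 4 := by positivity
  -- the family over `(u′, (y₁, w))`
  have hF : Summable fun s : Site (d + 1) × (Site (d + 1) × Site (d + 1)) =>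
      f (s.1 ν) * (m s.2 * mixOfK (unitK sf sm (coDressKBmAt (toSite r) Lc (KInvStep (d := d) Lc j))) Lc M₂ μ y ν s.1 s.2.1 s.2.2 a b) := by
    have hg : Summable fun u' : Site (d + 1) => Real.exp (-(m₀ / 2 / 4) * l1 ((Lc : ℤ) • y - (Lc : ℤ) • u')) :=
      (KernelLegCharges.summable_exp_coarse hLc hm8 ((Lc : ℤ) • y)).congr fun u' => by rw [l1_sub_symm]
    have hh : Summable fun yw : Site (d + 1) × Site (d + 1) =>
        Real.exp (-(m₀ / 2 / 4) * l1 (yw.1 - (Lc : ℤ) • y)) * Real.exp (-(m₀ / 2 / 4) * l1 (yw.2 - (Lc : ℤ) • y)) :=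
      (summable_exp_shift' hm8 _).mul_of_nonneg (summable_exp_shift' hm8 _) (fun _ => (Real.exp_pos _).le) (fun _ => (Real.exp_pos _).le)
    have hprod := Summable.mul_of_nonneg hg hh (fun _ => (Real.exp_pos _).le) (fun _ => mul_nonneg (Real.exp_pos _).le (Real.exp_pos _).le)
    refine Summable.of_norm_bounded (hprod.mul_left (B * cf)) (fun s => ?_)
    rw [Real.norm_eq_abs, abs_mul, abs_mul]
    have h : |mixOfK (unitK sf sm (coDressKBmAt (toSite r) Lc (KInvStep (d := d) Lc j))) Lc M₂ μ y ν s.1 s.2.1 s.2.2 a b|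
        ≤ cf * Real.exp (-(m₀ / 2 / 4) * l1 ((Lc : ℤ) • y - (Lc : ℤ) • s.1)) * Real.exp (-(m₀ / 2 / 4) * (l1 (s.2.1 - (Lc : ℤ) • y) + l1 (s.2.2 - (Lc : ℤ) • y))) :=
      (hW s.1 s.2.1 s.2.2 a b).trans (le_of_eq (by ring))
    calc |f (s.1 ν)| * (|m s.2| * |mixOfK _ Lc M₂ μ y ν s.1 s.2.1 s.2.2 a b|)
        ≤ B * (1 * (cf * Real.exp (-(m₀ / 2 / 4) * l1 ((Lc : ℤ) • y - (Lc : ℤ) • s.1)) * Real.exp (-(m₀ / 2 / 4) * (l1 (s.2.1 - (Lc : ℤ) • y) + l1 (s.2.2 - (Lc : ℤ) • y))))) :=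
          mul_le_mul (hf _) (mul_le_mul (hm _) h (abs_nonneg _) zero_le_one) (mul_nonneg (abs_nonneg _) (abs_nonneg _)) hB
      _ = B * cf * (Real.exp (-(m₀ / 2 / 4) * l1 ((Lc : ℤ) • y - (Lc : ℤ) • s.1)) *
            (Real.exp (-(m₀ / 2 / 4) * l1 (s.2.1 - (Lc : ℤ) • y)) * Real.exp (-(m₀ / 2 / 4) * l1 (s.2.2 - (Lc : ℤ) • y)))) := by
          rw [one_mul, mul_add, Real.exp_add]; ring
  have hF' : Summable (Function.uncurry fun (u' : Site (d + 1)) (yw : Site (d + 1) × Site (d + 1)) =>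
      f (u' ν) * (m yw * mixOfK (unitK sf sm (coDressKBmAt (toSite r) Lc (KInvStep (d := d) Lc j))) Lc M₂ μ y ν u' yw.1 yw.2 a b)) := hF
  rw [show (∑' u' : Site (d + 1), f (u' ν) * ∑' yw : Site (d + 1) × Site (d + 1), m yw *
        mixOfK (unitK sf sm (coDressKBmAt (toSite r) Lc (KInvStep (d := d) Lc j))) Lc M₂ μ y ν u' yw.1 yw.2 a b)
      = ∑' u' : Site (d + 1), ∑' yw : Site (d + 1) × Site (d + 1), f (u' ν) * (m yw *
        mixOfK (unitK sf sm (coDressKBmAt (toSite r) Lc (KInvStep (d := d) Lc j))) Lc M₂ μ y ν u' yw.1 yw.2 a b)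
      from tsum_congr fun u' => tsum_mul_left.symm, ← hF'.tsum_comm]
  have hin : ∀ yw : Site (d + 1) × Site (d + 1), ∑' u' : Site (d + 1), f (u' ν) * (m yw *
      mixOfK (unitK sf sm (coDressKBmAt (toSite r) Lc (KInvStep (d := d) Lc j))) Lc M₂ μ y ν u' yw.1 yw.2 a b) = 0 := by
    intro yw
    have h := (hasSum_coordWeight_mixOfK_snd hLc hr sf sm j hM₂ hδ₂ μ y ν f hf yw.1 yw.2 a b).mul_left (m yw)
    rw [mul_zero] at h
    rw [← h.tsum_eq]
    exact tsum_congr fun u' => by ring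
  simp_rw [hin]
  exact tsum_zero

/-- NOT IN PRINT; OUR BOOKKEEPING.  **THE EXCHANGED MIXED FACE WORD VANISHES** — its multiplier column sits at the CELL bond `(μ, r′)`, `r′ ∈ box P`: move the cell onto the
free bond `u′` (leaf-06 K4a `sum_box_tsum_swap_weight` at periods `(P, P)`; joint covariance by an2's `mixOfK_translate` — `M₂` jointly `Lc`-covariant — and the
`Lc·P`-periodicity of the leg weight), then every cell term is the direct word of `tsum_faceBond_mixWord_eq_zero` with the two columns' roles exchanged:
`Σ_{r′∈box P} Σ'_{u′} fμ(r′_μ)·fν(u′_ν)·Σ'_{(y₁,w)} m·mixOfK X̃ Lc M₂ ν u′ μ r′ (y₁,w)(a,b) = 0`. -/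
theorem sum_box_tsum_mixWord_swap_eq_zero (hLc : 1 ≤ Lc) (hr : r ∈ box (d + 1) Lc) (sf sm : ℝ) (j : ℕ) {P : ℕ} [NeZero P]
    {M₂ : Fin (d + 1) → Site (d + 1) → Fin (d + 1) → Site (d + 1) → MKer (d + 1) (Fib d)} {C₂ δ₂ : ℝ} (hM₂ : LocStencilFM Lc M₂ C₂ δ₂) (hδ₂ : 0 < δ₂)
    (hM₂t : ∀ (κ : Fin (d + 1)) (u : Site (d + 1)) (ρ : Fin (d + 1)) (w t : Site (d + 1)), M₂ κ (u + (Lc : ℤ) • t) ρ (w + t) = shiftK (-((Lc : ℤ) • t)) (M₂ κ u ρ w))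
    (μ ν : Fin (d + 1)) (fμ fν : ℤ → ℝ) {Bμ Bν : ℝ} (hfμ : ∀ s, |fμ s| ≤ Bμ) (hfν : ∀ s, |fν s| ≤ Bν)
    (hfμP : ∀ (u s : Site (d + 1)), fμ ((u + (P : ℤ) • s) μ) = fμ (u μ)) (hfνP : ∀ (u s : Site (d + 1)), fν ((u + (P : ℤ) • s) ν) = fν (u ν))
    (m : Site (d + 1) × Site (d + 1) → ℝ) (hm : ∀ yw, |m yw| ≤ 1)
    (hmN : ∀ (y₁ w₀ s : Site (d + 1)), m (y₁ + (Lc : ℤ) • ((P : ℤ) • s), w₀ + (Lc : ℤ) • ((P : ℤ) • s)) = m (y₁, w₀)) (a b : Fib d) :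
    ∑ r' ∈ box (d + 1) P, ∑' u' : Site (d + 1), fμ (toSite r' μ) * fν (u' ν) * ∑' yw : Site (d + 1) × Site (d + 1), m yw *
        mixOfK (unitK sf sm (coDressKBmAt (toSite r) Lc (KInvStep (d := d) Lc j))) Lc M₂ ν u' μ (toSite r') yw.1 yw.2 a b = 0 := by
  classical
  obtain ⟨δ, C', hδ, hC', hK'⟩ := decays_coDressKBmAt hLc hr (decays_KInvStep (d := d) (Lc := Lc) j)
  have hKu := decays_unitK (sf := sf) (sm := sm) hK'
  have hCK0 : 0 ≤ max |sf| |sm| * C' * max |sf| |sm| := hKu.nonneg (Sum.inl 0)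
  have hC₂ : 0 ≤ C₂ := hM₂.nonneg
  set m₀ : ℝ := min δ δ₂ with hm₀
  have hm0 : 0 < m₀ := lt_min hδ hδ₂
  have hKm : Decays (unitK sf sm (coDressKBmAt (toSite r) Lc (KInvStep (d := d) Lc j))) (max |sf| |sm| * C' * max |sf| |sm|) m₀ :=
    OneStepResolventKernel.decays_mono hKu hCK0 le_rfl (min_le_left δ δ₂)
  have hM₂m : LocStencilFM Lc M₂ C₂ m₀ := locStencilFM_mono hM₂ hC₂ (min_le_right _ _)
  have hBμ : 0 ≤ Bμ := (abs_nonneg _).trans (hfμ 0)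
  have hBν : 0 ≤ Bν := (abs_nonneg _).trans (hfν 0)
  have hm8 : 0 < m₀ / 2 / 4 := by positivity
  -- the word as a bi-sequence of its two bonds: first slot = the field-column bond `u′`, second = the multiplier-column bond `r′`
  set G : Site (d + 1) → Site (d + 1) → ℝ := fun r' u' => ∑' yw : Site (d + 1) × Site (d + 1), m yw *
    mixOfK (unitK sf sm (coDressKBmAt (toSite r) Lc (KInvStep (d := d) Lc j))) Lc M₂ ν u' μ r' yw.1 yw.2 a b with hGdef
  have hW := fun u' r' => biLoc_mixOfK_far (N := Lc) hKm hCK0 hM₂m hm0 ν u' μ r'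
  set cf : ℝ := (d + 1 : ℕ) * (max |sf| |sm| * C' * max |sf| |sm| * ((d + 1 : ℕ) * (max |sf| |sm| * C' * max |sf| |sm| * C₂ * Zl (d + 1) (m₀ / 2))) *
    Zl (d + 1) (m₀ / 2 / 4)) with hcf
  have hGb : ∀ r' u', |G r' u'| ≤ cf * (Zl (d + 1) (m₀ / 2 / 4) * Zl (d + 1) (m₀ / 2 / 4)) * Real.exp (-(m₀ / 2 / 4) * l1 ((Lc : ℤ) • u' - (Lc : ℤ) • r')) := by
    intro r' u'
    have h := abs_tsum_weightPair_le (hW u' r') hm8 m hm a b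
    exact h.trans (le_of_eq (by ring))
  have hXs : ∀ t : Site (d + 1), shiftK (-((Lc : ℤ) • t)) (unitK sf sm (coDressKBmAt (toSite r) Lc (KInvStep (d := d) Lc j)))
      = unitK sf sm (coDressKBmAt (toSite r) Lc (KInvStep (d := d) Lc j)) := by
    intro t
    show unitK sf sm (shiftK (-((Lc : ℤ) • t)) (coDressKBmAt (toSite r) Lc (KInvStep (d := d) Lc j))) = _
    rw [shiftK_coDressKBmAt (toSite r) hLc (shiftK_KInvStep (d := d) (Lc := Lc) j) t]
  have hmv : ∀ (s y₁ w₀ : Site (d + 1)), m (y₁ + -((Lc : ℤ) • ((P : ℤ) • s)), w₀ + -((Lc : ℤ) • ((P : ℤ) • s))) = m (y₁, w₀) := by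
    intro s y₁ w₀
    have h := hmN y₁ w₀ (-s)
    rwa [smul_neg, smul_neg] at h
  rw [sum_tsum_factor]
  rw [sum_box_tsum_swap_weight (P := P) (Q := P) G (fun u => fμ (u μ)) (fun u => fν (u ν))
      (fun r' u' s => by
        show (∑' yw : Site (d + 1) × Site (d + 1), m yw * mixOfK _ Lc M₂ ν (u' + (P : ℤ) • s) μ (r' + (P : ℤ) • s) yw.1 yw.2 a b) = _
        rw [mixOfK_translate (N := Lc) hXs hM₂t ν u' μ r' ((P : ℤ) • s), tsum_weightPair_shiftK m _ (hmv s)])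
      hfμP hfνP
      (fun r' => Summable.of_norm_bounded ((KernelLegCharges.summable_exp_coarse hLc hm8 ((Lc : ℤ) • r')).mul_left
          (Bν * (cf * (Zl (d + 1) (m₀ / 2 / 4) * Zl (d + 1) (m₀ / 2 / 4))))) (fun u' => by
        rw [Real.norm_eq_abs, abs_mul]
        calc |fν (u' ν)| * |G r' u'| ≤ Bν * (cf * (Zl (d + 1) (m₀ / 2 / 4) * Zl (d + 1) (m₀ / 2 / 4)) * Real.exp (-(m₀ / 2 / 4) * l1 ((Lc : ℤ) • u' - (Lc : ℤ) • r'))) :=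
              mul_le_mul (hfν _) (hGb r' u') (abs_nonneg _) hBν
          _ = _ := by ring))
      (fun u' => Summable.of_norm_bounded (((KernelLegCharges.summable_exp_coarse hLc hm8 ((Lc : ℤ) • u')).congr fun r' => by rw [l1_sub_symm]).mul_left
          (Bμ * (cf * (Zl (d + 1) (m₀ / 2 / 4) * Zl (d + 1) (m₀ / 2 / 4))))) (fun r' => by
        rw [Real.norm_eq_abs, abs_mul]
        calc |fμ (r' μ)| * |G r' u'| ≤ Bμ * (cf * (Zl (d + 1) (m₀ / 2 / 4) * Zl (d + 1) (m₀ / 2 / 4)) * Real.exp (-(m₀ / 2 / 4) * l1 ((Lc : ℤ) • u' - (Lc : ℤ) • r'))) :=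
              mul_le_mul (hfμ _) (hGb r' u') (abs_nonneg _) hBμ
          _ = _ := by ring))]
  refine Finset.sum_eq_zero fun u' _ => ?_
  rw [tsum_faceBond_mixWord_eq_zero hLc hr sf sm j hM₂ hδ₂ ν (toSite u') μ fμ hfμ m hm a b, mul_zero]

end MixFace

end Summit.QuantumFields.BalabanUV.Beta.GAN24.FaceWWordLetters
end
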